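import Summits.ValiantsHypothesis.ValiantsHypothesis.Theorems.GrenetZeonHessianRankCodimTwoLatinTable
import Summits.ValiantsHypothesis.ValiantsHypothesis.Theorems.GrenetZeonHessianRankCodimTwoLatinFrobeniusBlock
import HarnessLib

/-!
# Theorem P, glue A–B–C (permanent side): `permTable = latinPhi ℤ`

Crux `HessianRankCodimTwo` (stmt-ValiantsHypothesis-8061), line `good_plane` v2, Theorem P.  PART B
(8061-p4, `…LatinTable.lean`) normalises the permanent of the Latin block point to the colouring
table `permTable p`; PART A (8061-p3, `…LatinFrobeniusDefs/Block.lean`) phrases the Frobenius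
congruence for the coefficient `latinPhi R p = [y^{(p,p,p)}] Π_I ℓ_I^p`.  By p3's colouring/table
bridge `coeff_prod_rowForm_card` and p4's `prod_comp_rowBlock_eq` these are the same integer
polynomial (`permTable_eq_latinPhi`), so on the Latin plane `per = 0 ⇒ Φ̃_p(a) = 0` in the form
PART C consumes (`aeval_latinPhi_eq_zero_of_per_eq_zero`).  VP ≠ VNP is not moved.
-/

noncomputable section

open MvPolynomial Finset
open Literature.Computability.AlgebraicComplexity

-- single-conjunct layout `Summits/ValiantsHypothesis/ValiantsHypothesis`: duplicated namespace by design
set_option linter.dupNamespace false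

namespace Summit.ValiantsHypothesis.ValiantsHypothesis.Theorems.GrenetZeonHessianRankCodimTwo

variable {p : ℕ}

/-- The exponent vector `(p,p,p)` evaluates to `p` at every colour. [folklore] -/
theorem sum_single_const_apply (p : ℕ) (K : Fin 3) :
    (∑ K' : Fin 3, Finsupp.single K' p) K = p := by
  rw [Finsupp.finsetSum_apply, Finset.sum_eq_single K]
  · rw [Finsupp.single_eq_same]
  · intro K' _ hK'; rw [Finsupp.single_eq_of_ne hK'.symm]
  · intro h; exact absurd (Finset.mem_univ K) h

/-- **`permTable p = latinPhi ℤ p`**: PART B's colouring table is PART A's coefficient. [folklore] -/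
theorem permTable_eq_latinPhi (hp : 0 < p) : permTable p = latinPhi ℤ p := by
  classical
  rw [latinPhi, ← prod_comp_rowBlock_eq hp (rowForm ℤ), coeff_prod_rowForm_card, permTable]
  refine Finset.sum_congr (Finset.filter_congr fun u _ => ?_) fun _ _ => rfl
  refine forall_congr' fun K => ?_
  rw [Fintype.card_subtype, sum_single_const_apply]

/-- On the Latin block plane (`r = 0`), a vanishing permanent makes `Φ̃_p = latinPhi ℤ p` vanish at
the coordinates — the PART B hypothesis of `latinBlockNonvanishing_of_congruences`. [folklore] -/
theorem aeval_latinPhi_eq_zero_of_per_eq_zero (hp : 0 < p) (a : Fin 3 → ℂ)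
    (h : MvPolynomial.eval (latinPoint p 0 a) (perPoly (Fin (3 * p + 0)) ℂ) = 0) :
    aeval a (latinPhi ℤ p) = 0 := by
  rw [← permTable_eq_latinPhi hp]
  exact (eval_perPoly_latinPoint_zero_eq_zero_iff hp a).mp h

end Summit.ValiantsHypothesis.ValiantsHypothesis.Theorems.GrenetZeonHessianRankCodimTwo
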